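import Summits.CriticalPhenomena.PercolationContinuityZ3.Theorems.PercNearOneGluingNoHeavyQuantSGCTopLowCapacity
import Summits.CriticalPhenomena.PercolationContinuityZ3.Theorems.PercNearOneGluingNoHeavyQuantGateMoveBlobGeneralWitness
import HarnessLib

/-!
# QUANT lane R8, the GRADED-CLOSURE programme (lead g37 RULING V364): G₀ in the relay regime, the product row `d = 0`
# (companion of `…QuantDepthOneRelayRow` (rows of depth ≥ 1) and `…QuantDepthOneRelayRowTop` (shallow rows))

builds on p205010 (kernel theorem, internal audit signed; external expert review pending)

Support file (`--supports stmt-CriticalPhenomena-4575`), QUANT lane seat prim-quant-census-2 (gen 64), rung R8 of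
`run/shared/lean/prim/quant/LADDER.md`.  One theorem, standard axioms, no sorries, default heartbeats; a separate file only because of the 400-line cap.
Census memo: `run/shared/lean/prim/quant/prim-quant-census-2-g64/G0-CENSUS-G64.md` §6c.

WHAT.  For the partner `{0: 1−g, 1: g}` (`y ≤ g < 1`) and a big factor `μ ≥ 0` with target `T ≥ 1`, the product two-layer row at the threshold `d = 0`
(`u·(1−g)·μ(0) ≤ ν{≥ ⌈T+g⌉}`, `ν = (gate δ₁ g) ∗ μ`) follows from the ONE top-low-capacity row `(k, 0)` of `μ`, `k = ⌈T + g⌉ < M`, with weight `1` and no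
tilts: only the mids `k−1`, `k` can absorb the low `0`, at rates `≥ T/(k−T) ≥ (1−g)u` and `≥ T/(k−1−T) ≥ (1−g)u/g` (`heavy_le_usage`; `u = y/(1−y) < 1 ≤ T`).
With `relayConv_twoLayerRow_of_tlcRow` / `gateRelayConv_twoLayerRow_of_tlcRow` (depth `≥ 1`) and the shallow-row lemmas this completes the row list of memo §6c.

[this work]; usage / flows: prim-quant-stmt g22, prim-quant-census-2 g63; `heavy_le_usage`: this lane.  Nothing here is cited as a published result.  The gluing
rows served [cite: KozmaNitzan2024, Conjecture 3 (p. 15)]; product measure [cite: Grimmett1999, §1.3 p. 10].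
-/

noncomputable section

namespace Summit.CriticalPhenomena.PercolationContinuityZ3.Theorems

namespace Quant

open Finset

namespace LawDec


/-- **G₀ IN THE RELAY REGIME, the row `d = 0`** (partner `{0: 1−g, 1: g}`, `y ≤ g < 1`).  `0 < y < 1/2`, `μ ≥ 0`, a target `T ≥ 1`, `k` with
`T + g ≤ k < T + g + 1`, `k < M`.  If `μ` satisfies the top-low-capacity row `(k, 0)` at floor `y`, target `T` on `{0..M}`, then the two-layer row `0`
of `(gate δ₁ g) ∗ μ` at target `T + g` holds: `y/(1−y)·((1−g)·μ 0) ≤ (1−g)·Σ_{n ≤ M}[k ≤ n] μ n + g·Σ_{n ≤ M}[k−1 ≤ n] μ n`.  Certificate: the row itself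
with weight `1` on `{X₂ = 0}` (no tilts); the mids `k`, `k−1` absorb at rates `≥ T/(k−T) ≥ (1−g)u` and `≥ T/(k−1−T) ≥ (1−g)u/g` (`T ≥ 1 > u`). [this work] -/
theorem gateRelayConv_twoLayerRow_zero_of_tlcRow (y g T : ℝ) (M k : ℕ) (μ : ℕ → ℝ)
    (hy0 : 0 < y) (hy2 : 2 * y < 1) (hgy : y ≤ g) (hg1 : g < 1) (hμ0 : ∀ h, 0 ≤ μ h)
    (hT : 1 ≤ T) (hk1 : T + g ≤ (k : ℝ)) (hk2 : (k : ℝ) < T + g + 1) (hkM : k < M)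
    (hrow : y / (1 - y) * ∑ l ∈ Finset.range (0 + 1), μ l
      ≤ ∑ h ∈ Finset.range (M + 1), (if k + 1 ≤ h then μ h else 0)
        + y / (1 - y) * ∑ h ∈ Finset.range (M + 1),
            (if h ≤ k ∧ T < ((0 : ℕ) : ℝ) + h then μ h / usage y T k 0 h else 0)) :
    y / (1 - y) * ((1 - g) * μ 0)
      ≤ (1 - g) * ∑ n ∈ Finset.range (M + 1), (if k ≤ n then μ n else 0)
        + g * ∑ n ∈ Finset.range (M + 1), (if k - 1 ≤ n then μ n else 0) := by
  classical
  have hy1 : y < 1 := by linarith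
  have h1y : 0 < 1 - y := by linarith
  set u : ℝ := y / (1 - y) with hu
  have hu0 : 0 < u := div_pos hy0 h1y
  have hu1 : u < 1 := by rw [hu, div_lt_one h1y]; linarith
  have hg0 : 0 < g := lt_of_lt_of_le hy0 hgy
  have h1g : 0 < 1 - g := by linarith
  have hk2' : 2 ≤ k := by
    have : (1 : ℝ) < k := by linarith
    have : 1 < k := by exact_mod_cast this
    omega
  have hkM' : k < M + 1 := by omega
  have hlow : 2 * ((0 : ℕ) : ℝ) < T := by push_cast; linarith
  have hGk : ∑ n ∈ Finset.range (M + 1), (if k ≤ n then μ n else 0)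
      = μ k + ∑ n ∈ Finset.range (M + 1), (if k + 1 ≤ n then μ n else 0) := by
    have e : ∀ n ∈ Finset.range (M + 1), (if k ≤ n then μ n else 0)
        = (if n = k then μ n else 0) + (if k + 1 ≤ n then μ n else 0) := by
      intro n _
      by_cases h1 : n = k
      · subst h1; simp
      · by_cases h2 : k + 1 ≤ n
        · rw [if_pos (by omega), if_neg h1, if_pos h2, zero_add]
        · rw [if_neg (by omega), if_neg h1, if_neg h2, zero_add]
    rw [Finset.sum_congr rfl e, Finset.sum_add_distrib, Finset.sum_ite_eq' (Finset.range (M + 1)) k,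
      if_pos (Finset.mem_range.2 hkM')]
  have hGk1 : ∑ n ∈ Finset.range (M + 1), (if k - 1 ≤ n then μ n else 0)
      = μ (k - 1) + (μ k + ∑ n ∈ Finset.range (M + 1), (if k + 1 ≤ n then μ n else 0)) := by
    rw [← hGk]
    have e : ∀ n ∈ Finset.range (M + 1), (if k - 1 ≤ n then μ n else 0)
        = (if n = k - 1 then μ n else 0) + (if k ≤ n then μ n else 0) := by
      intro n _
      by_cases h1 : n = k - 1
      · subst h1; rw [if_pos le_rfl, if_pos rfl, if_neg (by omega), add_zero]
      · by_cases h2 : k ≤ n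
        · rw [if_pos (by omega), if_neg h1, if_pos h2, zero_add]
        · rw [if_neg (by omega), if_neg h1, if_neg h2, zero_add]
    rw [Finset.sum_congr rfl e, Finset.sum_add_distrib, Finset.sum_ite_eq' (Finset.range (M + 1)) (k - 1),
      if_pos (Finset.mem_range.2 (by omega))]
  -- the capacity sum: only h = k and h = k - 1
  have hcap : ∑ h ∈ Finset.range (M + 1), (if h ≤ k ∧ T < ((0 : ℕ) : ℝ) + h then μ h / usage y T k 0 h else 0)
      = (if T < ((0 : ℕ) : ℝ) + k then μ k / usage y T k 0 k else 0)
        + (if T < ((0 : ℕ) : ℝ) + ((k - 1 : ℕ) : ℝ) then μ (k - 1) / usage y T k 0 (k - 1) else 0) := by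
    have e : ∀ h ∈ Finset.range (M + 1), (if h ≤ k ∧ T < ((0 : ℕ) : ℝ) + h then μ h / usage y T k 0 h else 0)
        = (if h = k then (if T < ((0 : ℕ) : ℝ) + k then μ k / usage y T k 0 k else 0) else 0)
          + (if h = k - 1 then (if T < ((0 : ℕ) : ℝ) + ((k - 1 : ℕ) : ℝ) then μ (k - 1) / usage y T k 0 (k - 1) else 0) else 0) := by
      intro h _
      by_cases h1 : h = k
      · subst h1
        rw [if_pos (show h = h from rfl), if_neg (show ¬ (h = h - 1) by omega), add_zero]
        by_cases hc : T < ((0 : ℕ) : ℝ) + h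
        · rw [if_pos ⟨le_rfl, hc⟩, if_pos hc]
        · rw [if_neg (fun h' => hc h'.2), if_neg hc]
      · by_cases h2 : h = k - 1
        · subst h2
          rw [if_neg h1, if_pos rfl, zero_add]
          by_cases hc : T < ((0 : ℕ) : ℝ) + ((k - 1 : ℕ) : ℝ)
          · rw [if_pos ⟨by omega, hc⟩, if_pos hc]
          · rw [if_neg (fun h' => hc h'.2), if_neg hc]
        · rw [if_neg h1, if_neg h2, add_zero, if_neg]
          rintro ⟨hle, hc⟩
          have hle2 : h + 2 ≤ k := by omega
          have : (h : ℝ) + 2 ≤ k := by exact_mod_cast hle2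
          push_cast at hc
          linarith
    rw [Finset.sum_congr rfl e, Finset.sum_add_distrib, Finset.sum_ite_eq' (Finset.range (M + 1)) k,
      if_pos (Finset.mem_range.2 hkM'), Finset.sum_ite_eq' (Finset.range (M + 1)) (k - 1),
      if_pos (Finset.mem_range.2 (by omega))]
  have hμk : 0 ≤ μ k := hμ0 k
  have hμk1 : 0 ≤ μ (k - 1) := hμ0 (k - 1)
  have hμ0' : 0 ≤ μ 0 := hμ0 0
  -- mid k: usage ≥ T/(k - T) ≥ (1-g) u
  have hT1 : (1 - g) * (u * (if T < ((0 : ℕ) : ℝ) + k then μ k / usage y T k 0 k else 0)) ≤ μ k := by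
    split_ifs with hc
    · have hki : (1 - g) * u ≤ usage y T k 0 k := by
        refine le_trans ?_ (heavy_le_usage y T k 0 k hy0 hy1 le_rfl hlow hc)
        have hden : 0 < ((0 : ℕ) : ℝ) + k - T := by linarith
        rw [le_div_iff₀ hden]; push_cast
        have hkT : (k : ℝ) - T < g + 1 := by linarith
        have hpos : 0 < (1 - g) * u := mul_pos h1g hu0
        have h1 : (1 - g) * u * (0 + (k : ℝ) - T) ≤ (1 - g) * u * (g + 1) :=
          mul_le_mul_of_nonneg_left (by linarith) hpos.le
        have h2 : (1 - g) * u * (g + 1) ≤ u := by nlinarith [sq_nonneg g]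
        linarith
      have hpos : 0 < (1 - g) * u := mul_pos h1g hu0
      have := div_le_div_of_nonneg_left hμk hpos hki
      calc (1 - g) * (u * (μ k / usage y T k 0 k)) ≤ (1 - g) * (u * (μ k / ((1 - g) * u))) := by
            exact mul_le_mul_of_nonneg_left (mul_le_mul_of_nonneg_left this hu0.le) h1g.le
        _ = μ k := by field_simp
    · rw [mul_zero, mul_zero]; exact hμk
  -- mid k - 1: usage ≥ T/(k - 1 - T) ≥ (1-g) u / g
  have hT2 : (1 - g) * (u * (if T < ((0 : ℕ) : ℝ) + ((k - 1 : ℕ) : ℝ) then μ (k - 1) / usage y T k 0 (k - 1) else 0))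
      ≤ g * μ (k - 1) := by
    split_ifs with hc
    · have hk' : (((k - 1 : ℕ) : ℝ)) = (k : ℝ) - 1 := by
        rw [Nat.cast_sub (by omega : 1 ≤ k)]; push_cast; ring
      have hkii : (1 - g) * u / g ≤ usage y T k 0 (k - 1) := by
        refine le_trans ?_ (heavy_le_usage y T k 0 (k - 1) hy0 hy1 (by omega) hlow hc)
        have hden : 0 < ((0 : ℕ) : ℝ) + ((k - 1 : ℕ) : ℝ) - T := by linarith
        rw [div_le_div_iff₀ hg0 hden]; push_cast
        rw [hk'] at hc ⊢
        have : (k : ℝ) - 1 - T < g := by linarith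
        nlinarith [mul_pos h1g hu0, mul_pos hg0 hu0]
      have hpos : 0 < (1 - g) * u / g := div_pos (mul_pos h1g hu0) hg0
      have := div_le_div_of_nonneg_left hμk1 hpos hkii
      calc (1 - g) * (u * (μ (k - 1) / usage y T k 0 (k - 1))) ≤ (1 - g) * (u * (μ (k - 1) / ((1 - g) * u / g))) := by
            exact mul_le_mul_of_nonneg_left (mul_le_mul_of_nonneg_left this hu0.le) h1g.le
        _ = g * μ (k - 1) := by field_simp
    · rw [mul_zero, mul_zero]; exact mul_nonneg hg0.le hμk1
  rw [hcap] at hrow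
  rw [hGk, hGk1]
  have hA : ∑ l ∈ Finset.range (0 + 1), μ l = μ 0 := by simp
  rw [hA] at hrow
  have c1 := mul_le_mul_of_nonneg_left hrow h1g.le
  nlinarith [c1, hT1, hT2, mul_nonneg hg0.le (Finset.sum_nonneg fun n (_ : n ∈ Finset.range (M + 1)) =>
    (show (0 : ℝ) ≤ (if k + 1 ≤ n then μ n else 0) by split_ifs; exacts [hμ0 n, le_rfl])),
    mul_add ((1 - g) * u) (if T < ((0 : ℕ) : ℝ) + k then μ k / usage y T k 0 k else 0)
      (if T < ((0 : ℕ) : ℝ) + ((k - 1 : ℕ) : ℝ) then μ (k - 1) / usage y T k 0 (k - 1) else 0), hμk, mul_nonneg hg0.le hμk]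

end LawDec

end Quant

end Summit.CriticalPhenomena.PercolationContinuityZ3.Theorems
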